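import Summits.QuantumAdvantage.QuantumAdvantage.Theorems.LinnikCubicClassGroupsDegreeOnePrimesEscapeDivisionPNTTheta
import Summits.QuantumAdvantage.QuantumAdvantage.Theorems.LinnikCubicClassGroupsDegreeOnePrimesEscapeDivisionPNTCount
import HarnessLib

/-!
# The Chebotarev prime number theorem for Frobenius DIVISIONS in the Linnik range, with relative error

Topic `Summits/QuantumAdvantage/QuantumAdvantage/Theorems`, cell B2b-1 (linnik-cubic), PART A (gen 10);
helper toward the crux `DegreeOnePrimesEscape` (stmt-QuantumAdvantage-11543) of route
`LinnikCubicClassGroups`.  HONEST FRAMING: the value of this file is a THEOREM (kernel-checked, GRH-free,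
Siegel-free, no hypothesis) — NOT summit progress.

**Theorem** (`division_PNT`).  For `n > 1` and `0 < ε ≤ 1` there are `L = L(n,ε) > 0` and `c = c(n,ε) > 0`
such that for every Galois number field `N/ℚ` of degree `n`, every `σ ∈ G = Gal(N/ℚ)`, with
`δ = |Div σ|/|G|` the Chebotarev density of the DIVISION of `σ` (`Div σ = {τ : ⟨g τ g⁻¹⟩ = ⟨σ⟩ for some g}`),
`d = |d_N|`, and `S(x) = Σ_{p ≤ x, p ∤ d_N, Frob_p ∈ Div σ} log p`:

* (A) if `ζ_N` has no real zero in `(1 − c/(log d + log 4), 1)`: `|S(x) − δ x| ≤ ε δ x` for every `x ≥ d^L`;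
* (B) if `β₁` is such a zero (it is unique by Landau–Page), then for every `x ≥ d^L`, with `y = x^{β₁}/β₁`:
  `0 < x − y` and `|S(x) − δ (x − y)| ≤ ε δ (x − y)` when `ζ_{N^{⟨σ⟩}}(β₁) = 0` (i.e. `σ ∈ K₁`, the kernel of
  the exceptional quadratic character), and `|S(x) − δ (x + y)| ≤ ε δ (x + y)` when `ζ_{N^{⟨σ⟩}}(β₁) ≠ 0`.

This is the Linnik-range prime number theorem of Lagarias–Montgomery–Odlyzko / Thorner–Zaman
[LagariasMontgomeryOdlyzko1979, Thm 1.1; ThornerZaman2019, Thm 1.4 (shape)] for the conjugacy-stable sets that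
Dedekind zeta functions alone can see — the divisions (Frobenius 1896) — with an inexplicit exponent `L(n, ε)`:
`S(x) = δ (x − χ_{K₁}(σ) x^{β₁}/β₁)(1 + O(ε))`.  It refines the existence theorem `exists_frobenius_generates_le`
(`…ChebotarevDivision.lean`).  Proof: `divisionTheta_twoSided` (the Möbius combination of subfield prime ideal
theorems, two-sided) + the exact prime count `abs_divisionTheta_sub_le` and `δ = m M/|N_G(⟨σ⟩)|`
(`…DivisionPNTCount.lean`).  Corollaries (upper/lower bounds, prime counts) are in `…DivisionPNTBounds.lean`.
-/

noncomputable section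

open scoped NumberField nonZeroDivisors
open Finset Real Ideal NumberField
open Literature.NumberTheory.NumberFields Literature.NumberTheory.LFunctions
  Literature.NumberTheory.LFunctions.NumberField

namespace Summit.QuantumAdvantage.QuantumAdvantage.Theorems.DegreeOnePrimesEscape

/-- From `|T − M·Main| ≤ (ε/2) M Main`, `|T − ν S| ≤ R ≤ (ε/2) M Main` and `δ ν = M` (`ν > 0`):
`|S − δ Main| ≤ ε δ Main`. -/
theorem division_transfer {T S M Main ν δ R ε : ℝ} (hν : 0 < ν) (hδ : δ * ν = M)
    (h1 : |T - M * Main| ≤ ε / 2 * (M * Main)) (h2 : |T - ν * S| ≤ R) (h3 : R ≤ ε / 2 * (M * Main)) :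
    |S - δ * Main| ≤ ε * (δ * Main) := by
  have hkey : |ν * S - M * Main| ≤ ε * (M * Main) := by
    calc |ν * S - M * Main| = |(ν * S - T) + (T - M * Main)| := by ring_nf
      _ ≤ |ν * S - T| + |T - M * Main| := abs_add_le _ _
      _ ≤ R + ε / 2 * (M * Main) := by rw [abs_sub_comm]; exact add_le_add h2 h1
      _ ≤ ε * (M * Main) := by linarith
  have e1 : ν * S - M * Main = ν * (S - δ * Main) := by rw [← hδ]; ring
  have e2 : ε * (M * Main) = ν * (ε * (δ * Main)) := by rw [← hδ]; ring
  rw [e1, e2, abs_mul, abs_of_pos hν] at hkey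
  exact le_of_mul_le_mul_left hkey hν

set_option maxHeartbeats 4000000 in
open scoped Classical in
/-- **The Chebotarev prime number theorem for Frobenius divisions in the Linnik range, relative error `ε`**
(see the module docstring; `δ = |Div σ|/|G|`, `S(x) = Σ_{p ≤ x, p ∤ d_N, Frob_p ∈ Div σ} log p`, `d = |d_N|`):
(A) no real zero of `ζ_N` in `(1 − c/(log d + log 4), 1)` ⟹ `|S(x) − δx| ≤ εδx` for `x ≥ d^L`;
(B) `β₁` such a zero, `y = x^{β₁}/β₁` ⟹ for `x ≥ d^L`: `0 < x − y ∧ |S(x) − δ(x − y)| ≤ εδ(x − y)` if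
`ζ_{N^{⟨σ⟩}}(β₁) = 0`, and `|S(x) − δ(x + y)| ≤ εδ(x + y)` otherwise.  Unconditional.
[cite: LagariasMontgomeryOdlyzko1979, Theorem 1.1] [cite: ThornerZaman2019, Theorem 1.4] -/
theorem division_PNT (n : ℕ) (hn : 1 < n) {ε : ℝ} (hε : 0 < ε) (hε1 : ε ≤ 1) :
    ∃ L c : ℝ, 0 < L ∧ 0 < c ∧ c ≤ 1 / 4 ∧ ∀ (N : Type) [Field N] [NumberField N] [IsGalois ℚ N],
      Module.finrank ℚ N = n → ∀ σ : N ≃ₐ[ℚ] N,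
        ((¬ ∃ β₁ : ℝ, dedekindZeta₁ N β₁ = 0 ∧
            1 - c / (Real.log ((NumberField.discr N).natAbs : ℝ) + Real.log 4) < β₁ ∧ β₁ < 1) →
          ∀ x : ℝ, ((NumberField.discr N).natAbs : ℝ) ^ L ≤ x →
            |∑ p ∈ (Nat.primesLE ⌊x⌋₊).filter
                (fun p : ℕ => ¬ ((p : ℤ) ∣ NumberField.discr N) ∧
                  ∃ (Q : Ideal (𝓞 N)) (_ : Q.IsMaximal) (_ : Q.LiesOver (span {(p : ℤ)})) (φ g : N ≃ₐ[ℚ] N),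
                    IsArithFrobAt ℤ φ Q ∧ Q.inertia (N ≃ₐ[ℚ] N) = ⊥ ∧
                      Subgroup.zpowers (g * φ * g⁻¹) = Subgroup.zpowers σ), Real.log p -
              (Nat.card {τ : N ≃ₐ[ℚ] N // ∃ g : N ≃ₐ[ℚ] N,
                  Subgroup.zpowers (g * τ * g⁻¹) = Subgroup.zpowers σ} : ℝ) / Nat.card (N ≃ₐ[ℚ] N) * x| ≤
              ε * ((Nat.card {τ : N ≃ₐ[ℚ] N // ∃ g : N ≃ₐ[ℚ] N,
                  Subgroup.zpowers (g * τ * g⁻¹) = Subgroup.zpowers σ} : ℝ) / Nat.card (N ≃ₐ[ℚ] N) * x)) ∧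
        (∀ β₁ : ℝ, dedekindZeta₁ N β₁ = 0 →
          1 - c / (Real.log ((NumberField.discr N).natAbs : ℝ) + Real.log 4) < β₁ → β₁ < 1 →
          (dedekindZeta₁ (IntermediateField.fixedField (Subgroup.zpowers σ)) β₁ = 0 →
            ∀ x : ℝ, ((NumberField.discr N).natAbs : ℝ) ^ L ≤ x →
              0 < x - x ^ β₁ / β₁ ∧
              |∑ p ∈ (Nat.primesLE ⌊x⌋₊).filter
                  (fun p : ℕ => ¬ ((p : ℤ) ∣ NumberField.discr N) ∧
                    ∃ (Q : Ideal (𝓞 N)) (_ : Q.IsMaximal) (_ : Q.LiesOver (span {(p : ℤ)})) (φ g : N ≃ₐ[ℚ] N),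
                      IsArithFrobAt ℤ φ Q ∧ Q.inertia (N ≃ₐ[ℚ] N) = ⊥ ∧
                        Subgroup.zpowers (g * φ * g⁻¹) = Subgroup.zpowers σ), Real.log p -
                (Nat.card {τ : N ≃ₐ[ℚ] N // ∃ g : N ≃ₐ[ℚ] N,
                    Subgroup.zpowers (g * τ * g⁻¹) = Subgroup.zpowers σ} : ℝ) / Nat.card (N ≃ₐ[ℚ] N) *
                  (x - x ^ β₁ / β₁)| ≤
                ε * ((Nat.card {τ : N ≃ₐ[ℚ] N // ∃ g : N ≃ₐ[ℚ] N,
                    Subgroup.zpowers (g * τ * g⁻¹) = Subgroup.zpowers σ} : ℝ) / Nat.card (N ≃ₐ[ℚ] N) *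
                  (x - x ^ β₁ / β₁))) ∧
          (dedekindZeta₁ (IntermediateField.fixedField (Subgroup.zpowers σ)) β₁ ≠ 0 →
            ∀ x : ℝ, ((NumberField.discr N).natAbs : ℝ) ^ L ≤ x →
              |∑ p ∈ (Nat.primesLE ⌊x⌋₊).filter
                  (fun p : ℕ => ¬ ((p : ℤ) ∣ NumberField.discr N) ∧
                    ∃ (Q : Ideal (𝓞 N)) (_ : Q.IsMaximal) (_ : Q.LiesOver (span {(p : ℤ)})) (φ g : N ≃ₐ[ℚ] N),
                      IsArithFrobAt ℤ φ Q ∧ Q.inertia (N ≃ₐ[ℚ] N) = ⊥ ∧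
                        Subgroup.zpowers (g * φ * g⁻¹) = Subgroup.zpowers σ), Real.log p -
                (Nat.card {τ : N ≃ₐ[ℚ] N // ∃ g : N ≃ₐ[ℚ] N,
                    Subgroup.zpowers (g * τ * g⁻¹) = Subgroup.zpowers σ} : ℝ) / Nat.card (N ≃ₐ[ℚ] N) *
                  (x + x ^ β₁ / β₁)| ≤
                ε * ((Nat.card {τ : N ≃ₐ[ℚ] N // ∃ g : N ≃ₐ[ℚ] N,
                    Subgroup.zpowers (g * τ * g⁻¹) = Subgroup.zpowers σ} : ℝ) / Nat.card (N ≃ₐ[ℚ] N) *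
                  (x + x ^ β₁ / β₁)))) := by
  have hn0 : (0 : ℝ) < n := by exact_mod_cast (lt_trans Nat.zero_lt_one hn)
  have hn1 : (1 : ℝ) ≤ n := by exact_mod_cast hn.le
  have hε2 : 0 < ε / 2 := half_pos hε
  have hε21 : ε / 2 ≤ 1 := by linarith
  obtain ⟨L₁, c, hL₁, hc, hc4, hT⟩ := divisionTheta_twoSided n hn hε2 hε21
  obtain ⟨c₁, hc₁, hc₁1, hMT⟩ := exceptional_mainTerm_ge n hn
  have hX1 : (1 : ℝ) ≤ Real.exp 16 := Real.one_le_exp (by norm_num)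
  obtain ⟨L₂, hL₂, -, -, hthr⟩ := division_thresholds_eps n hn 0 hc₁ hc₁1 hX1 le_rfl hε2 hε21
  set L : ℝ := max L₁ L₂ with hL
  refine ⟨L, c, lt_of_lt_of_le hL₁ (le_max_left _ _), hc, hc4, fun N _ _ _ hN σ => ?_⟩
  obtain ⟨hA, hB⟩ := hT N hN σ
  -- sizes depending on `N`, `σ`
  have hN1 : 1 < Module.finrank ℚ N := by rw [hN]; exact hn
  set d : ℝ := ((NumberField.discr N).natAbs : ℝ) with hd
  have hd3 : (3 : ℝ) ≤ d := three_le_natAbs_discr_real N hN1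
  obtain ⟨hd0, hd1⟩ : (0 : ℝ) < d ∧ (1 : ℝ) ≤ d := ⟨by linarith, by linarith⟩
  have hlogd0 : 0 < Real.log d := Real.log_pos (by linarith)
  set m : ℕ := orderOf σ with hm
  have hm0' : (0 : ℝ) < m := by exact_mod_cast orderOf_pos σ
  set M : ℝ := ∑ t ∈ m.divisors, (ArithmeticFunction.moebius t : ℝ) / t with hMdef
  have hM : 1 / ((n : ℝ) ^ 2) ≤ M := sum_moebius_div_ge_inv_sq hN hn σ
  set ν : ℝ := (Nat.card (Subgroup.normalizer (Subgroup.zpowers σ : Set (N ≃ₐ[ℚ] N))) : ℝ) / orderOf σ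
    with hν
  have hνpos : 0 < ν := by
    rw [hν]
    exact div_pos (by exact_mod_cast lt_of_lt_of_le (orderOf_pos σ) (orderOf_le_card_normalizer σ)) hm0'
  set δ : ℝ := (Nat.card {τ : N ≃ₐ[ℚ] N // ∃ g : N ≃ₐ[ℚ] N,
      Subgroup.zpowers (g * τ * g⁻¹) = Subgroup.zpowers σ} : ℝ) / Nat.card (N ≃ₐ[ℚ] N) with hδ
  have hδν : δ * ν = M := by
    rw [hδ, divisionDensity_eq σ, hν, hMdef, hm]
    have hNpos : (0 : ℝ) < Nat.card (Subgroup.normalizer (Subgroup.zpowers σ : Set (N ≃ₐ[ℚ] N))) := by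
      exact_mod_cast lt_of_lt_of_le (orderOf_pos σ) (orderOf_le_card_normalizer σ)
    field_simp
    exact mul_div_cancel_left₀ _ (ne_of_gt hm0')
  -- the transfer at a fixed `x ≥ d^L`
  have hLx : ∀ x : ℝ, d ^ L ≤ x → d ^ L₁ ≤ x ∧ d ^ L₂ ≤ x := fun x hx =>
    ⟨(Real.rpow_le_rpow_of_exponent_le hd1 (le_max_left _ _)).trans hx,
      (Real.rpow_le_rpow_of_exponent_le hd1 (le_max_right _ _)).trans hx⟩
  have hcount := fun x => abs_divisionTheta_sub_le σ x
  have hstep : ∀ x Main : ℝ, d ^ L ≤ x →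
      |∑ t ∈ m.divisors, (ArithmeticFunction.moebius t : ℝ) / t *
          degreeOneTheta (IntermediateField.fixedField (Subgroup.zpowers (σ ^ t))) x - M * Main| ≤
        ε / 2 * (M * Main) →
      (n : ℝ) ^ 2 * Real.log d ≤ ε / 2 * (M * Main) →
      |∑ p ∈ (Nat.primesLE ⌊x⌋₊).filter
          (fun p : ℕ => ¬ ((p : ℤ) ∣ NumberField.discr N) ∧
            ∃ (Q : Ideal (𝓞 N)) (_ : Q.IsMaximal) (_ : Q.LiesOver (span {(p : ℤ)})) (φ g : N ≃ₐ[ℚ] N),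
              IsArithFrobAt ℤ φ Q ∧ Q.inertia (N ≃ₐ[ℚ] N) = ⊥ ∧
                Subgroup.zpowers (g * φ * g⁻¹) = Subgroup.zpowers σ), Real.log p - δ * Main| ≤
        ε * (δ * Main) := by
    intro x Main _ h1 h3
    have h2 := hcount x
    rw [hN] at h2
    exact division_transfer hνpos hδν h1 h2 h3
  refine ⟨?_, ?_⟩
  · -- (A)
    intro hexc x hx
    obtain ⟨hx₁, hx₂⟩ := hLx x hx
    have hx0 : 0 < x := lt_of_lt_of_le (Real.rpow_pos_of_pos hd0 L) hx
    obtain ⟨-, -, hlogj, -, -⟩ := hthr d hd3 x hx₂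
    have h1 := hA hexc x hx₁
    refine hstep x x hx h1 ?_
    -- `n² log d ≤ (ε/2) x/(4n²) ≤ (ε/2) M x`
    have h4 : (n : ℝ) ^ 2 * Real.log d ≤ ((n : ℝ) ^ 2 + n) * Real.log d := by nlinarith
    have h5 : ε / 2 * x / (4 * n ^ 2) ≤ ε / 2 * (M * x) := by
      rw [div_le_iff₀ (by positivity)]
      have : ε / 2 * x ≤ ε / 2 * (M * x) * n ^ 2 := by
        have hMn : 1 ≤ M * n ^ 2 := by
          have := mul_le_mul_of_nonneg_right hM (by positivity : (0 : ℝ) ≤ n ^ 2)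
          rwa [one_div, inv_mul_cancel₀ (by positivity)] at this
        nlinarith [mul_pos hε2 hx0]
      nlinarith [mul_pos hε2 hx0, le_trans (by positivity) hM]
    linarith
  · -- (B)
    intro β₁ hζ₁ hβ₁c hβ₁1
    obtain ⟨hB1, hB2⟩ := hB β₁ hζ₁ hβ₁c hβ₁1
    have hlog4 : 0 < Real.log 4 := Real.log_pos (by norm_num)
    have hβ34 : 3 / 4 ≤ β₁ := by
      have : c / (Real.log d + Real.log 4) ≤ 1 / 4 := by
        rw [div_le_iff₀ (by linarith)]
        have hlog4' : 1 < Real.log 4 := by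
          rw [show (4:ℝ) = 2 ^ 2 by norm_num, Real.log_pow]; have := Real.log_two_gt_d9; push_cast; linarith
        nlinarith
      linarith
    have hβ0 : 0 < β₁ := by linarith
    refine ⟨?_, ?_⟩
    · intro hζσ x hx
      obtain ⟨hx₁, hx₂⟩ := hLx x hx
      have hx0 : 0 < x := lt_of_lt_of_le (Real.rpow_pos_of_pos hd0 L) hx
      obtain ⟨hXx, -, -, -, hj2⟩ := hthr d hd3 x hx₂
      have hx16 : 16 ≤ Real.log x := by
        have := Real.log_le_log (Real.exp_pos 16) hXx; rwa [Real.log_exp] at this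
      have hx1 : 1 < x := by linarith [Real.add_one_le_exp (16 : ℝ)]
      obtain ⟨hxy, h1⟩ := hB1 hζσ x hx₁
      refine ⟨hxy, hstep x (x - x ^ β₁ / β₁) hx h1 ?_⟩
      -- `n² log d ≤ (ε/2) W/(4n²) ≤ (ε/2) M (x − y)`
      have hWxy : x * c₁ / (4 * d ^ (2 * ((1 : ℝ) + n * n))) ≤ x - x ^ β₁ / β₁ :=
        hMT N hN β₁ hζ₁ hβ34 hβ₁1 x hx1 hx16
      have hW0 : 0 < x * c₁ / (4 * d ^ (2 * ((1 : ℝ) + n * n))) := by positivity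
      have h5 : ε / 2 * (x * c₁ / (4 * d ^ (2 * ((1 : ℝ) + n * n)))) / (4 * n ^ 2) ≤
          ε / 2 * (M * (x - x ^ β₁ / β₁)) := by
        rw [div_le_iff₀ (by positivity)]
        have hMn : 1 ≤ M * n ^ 2 := by
          have := mul_le_mul_of_nonneg_right hM (by positivity : (0 : ℝ) ≤ n ^ 2)
          rwa [one_div, inv_mul_cancel₀ (by positivity)] at this
        have hMxy : x * c₁ / (4 * d ^ (2 * ((1 : ℝ) + n * n))) ≤ M * (x - x ^ β₁ / β₁) * n ^ 2 := by
          nlinarith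
        nlinarith [le_trans (by positivity) hM]
      linarith
    · intro hζσ x hx
      obtain ⟨hx₁, hx₂⟩ := hLx x hx
      have hx0 : 0 < x := lt_of_lt_of_le (Real.rpow_pos_of_pos hd0 L) hx
      obtain ⟨-, -, hlogj, -, -⟩ := hthr d hd3 x hx₂
      have hy0 : 0 ≤ x ^ β₁ / β₁ := div_nonneg (Real.rpow_nonneg hx0.le _) hβ0.le
      have h1 := hB2 hζσ x hx₁
      refine hstep x (x + x ^ β₁ / β₁) hx h1 ?_
      have h4 : (n : ℝ) ^ 2 * Real.log d ≤ ((n : ℝ) ^ 2 + n) * Real.log d := by nlinarith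
      have hM0 : 0 ≤ M := le_trans (by positivity) hM
      have h5 : ε / 2 * x / (4 * n ^ 2) ≤ ε / 2 * (M * (x + x ^ β₁ / β₁)) := by
        rw [div_le_iff₀ (by positivity)]
        have hMn : 1 ≤ M * n ^ 2 := by
          have := mul_le_mul_of_nonneg_right hM (by positivity : (0 : ℝ) ≤ n ^ 2)
          rwa [one_div, inv_mul_cancel₀ (by positivity)] at this
        have hMx : x ≤ M * (x + x ^ β₁ / β₁) * n ^ 2 := by nlinarith
        nlinarith
      linarith

end Summit.QuantumAdvantage.QuantumAdvantage.Theorems.DegreeOnePrimesEscape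

end
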